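import Literature.MathematicalPhysics.QuantumLattice.WilsonPropagatorHeavyMass
import Literature.Barriers.QuantumFields.HoppingExpansionLocality
import Summits.QuantumFields.QCD.Theorems.SeaNonGibbsUniformLoopPotentialMatrix
import HarnessLib

/-!
# Locality structure of the Wilson–Dirac matrix under a single-link update

Route `SeaNonGibbs` (QCD), item `UniformLoopPotential` (stmt-QuantumFields-8858), lattice part:
for the tree's `wilsonDirac ρ U m 1` on the four-torus (any unitary `ρ`, any gauge field):

* the `ℓ¹` torus distance `Σ_i |x_i − y_i|` (cyclic, `ZMod.valMinAbs`) — triangle inequality, one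
  hop has length `≤ 1`, the Wilson matrix has range one, so its powers `Xʲ` do not connect indices
  at distance `> j` (tree `HoppingExpansion.pow_apply_eq_zero_of_lt`) and `P_S Xʲ P_F = 0` for blocks at distance
  `> j` (`proj_pow_proj_eq_zero`);
* the two-sided Neumann tail bound `‖P_S (1−A)⁻¹ Δ (1−A')⁻¹ P_S‖ ≤ θ^d (1−θ)⁻¹ ‖Δ‖ (1−θ)⁻¹ θ^d`
  for range-one `A, A'` of norm `≤ θ < 1` and `Δ` supported at distance `≥ d` from `S`
  (`norm_proj_inv_mul_inv_proj_le`);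
* the single-link update: `D(U[e₀ ↦ u]) − D(U[e₀ ↦ u'])` does not depend on the other links
  (`wilsonDirac_update_sub_update_eq`) and is supported on the two endpoints of `e₀`
  (`wilsonDirac_update_sub_update_apply_eq_zero`); two fields agreeing on the links within
  distance `L` of `e₀` have Wilson matrices agreeing except on indices at distance `≥ L`
  (`wilsonDirac_update_apply_eq_of_agree`). Lattice linear algebra only (seat ym-line-fcl-p3 g19). -/

noncomputable section

open Matrix Finset
open scoped Matrix.Norms.L2Operator
open Literature.Probability.LatticeModels (TorusSite)
open Literature.MathematicalPhysics.QuantumFieldTheory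
open Literature.MathematicalPhysics.QuantumLattice
open Literature.Barriers.QuantumFields (HoppingExpansion.pow_apply_eq_zero_of_lt)

namespace Summit.QuantumFields.QCD.Theorems

namespace UniformLoopPotential

section RangeOne

variable {ι : Type*} [Fintype ι] [DecidableEq ι]

/-- **Blocks at distance `> j` are not connected by `Xʲ`**: `P_S Xʲ P_F = 0`. -/
theorem proj_pow_proj_eq_zero (dist : ι → ι → ℕ) (hd0 : ∀ x, dist x x = 0)
    (htri : ∀ x y z, dist x z ≤ dist x y + dist y z) (A : Matrix ι ι ℂ)
    (hA : ∀ x y, A x y ≠ 0 → dist x y ≤ 1) (pS pF : ι → Prop) [DecidablePred pS]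
    [DecidablePred pF] {j : ℕ} (hfar : ∀ x y, pS x → pF y → j < dist x y) :
    (Matrix.diagonal fun k => if pS k then (1 : ℂ) else 0) * A ^ j *
      (Matrix.diagonal fun k => if pF k then (1 : ℂ) else 0) = 0 := by
  ext x y
  rw [Matrix.mul_diagonal, Matrix.diagonal_mul, Matrix.zero_apply]
  by_cases hx : pS x
  · by_cases hy : pF y
    · rw [HoppingExpansion.pow_apply_eq_zero_of_lt dist hd0 htri A hA j x y (hfar x y hx hy)]; simp
    · simp [hy]
  · simp [hx]

/-- The transposed statement `P_F Xʲ P_S = 0`. -/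
theorem proj_pow_proj_eq_zero' (dist : ι → ι → ℕ) (hd0 : ∀ x, dist x x = 0)
    (htri : ∀ x y z, dist x z ≤ dist x y + dist y z) (hsymm : ∀ x y, dist x y = dist y x)
    (A : Matrix ι ι ℂ) (hA : ∀ x y, A x y ≠ 0 → dist x y ≤ 1) (pS pF : ι → Prop)
    [DecidablePred pS] [DecidablePred pF] {j : ℕ} (hfar : ∀ x y, pS x → pF y → j < dist x y) :
    (Matrix.diagonal fun k => if pF k then (1 : ℂ) else 0) * A ^ j *
      (Matrix.diagonal fun k => if pS k then (1 : ℂ) else 0) = 0 :=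
  proj_pow_proj_eq_zero dist hd0 htri A hA pF pS fun x y hx hy => by
    rw [hsymm]; exact hfar y x hy hx

/-- Right-sided resummed Neumann identity `S = Σ_{n<d} xⁿ + S x^d` from `S (1 − x) = 1`. -/
theorem geom_series_eq_sum_add_mul_pow {R : Type*} [Ring R] {x S : R} (h : S * (1 - x) = 1)
    (d : ℕ) : S = (∑ n ∈ Finset.range d, x ^ n) + S * x ^ d := by
  have hS : S = 1 + S * x := by
    rw [mul_sub, mul_one] at h
    exact sub_eq_iff_eq_add.1 h
  induction d with
  | zero => simp
  | succ d ih =>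
    have hstep : S * x ^ d = x ^ d + S * x ^ (d + 1) := by
      conv_lhs => rw [hS]
      rw [add_mul, one_mul, mul_assoc, ← pow_succ']
    rw [Finset.sum_range_succ, add_assoc, ← hstep]
    exact ih

/-- **Two-sided Neumann tail bound.** For range-one `A, A'` with `‖A‖, ‖A'‖ ≤ θ < 1`, a matrix
`Δ = P_F Δ P_F` supported on `F`, and a block `S` at distance `> d − 1` from `F`
(`d ≤ dist(S, F)`): `‖P_S (1−A)⁻¹ Δ (1−A')⁻¹ P_S‖ ≤ θ^d (1−θ)⁻¹ ‖Δ‖ (1−θ)⁻¹ θ^d`. -/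
theorem norm_proj_inv_mul_inv_proj_le (dist : ι → ι → ℕ) (hd0 : ∀ x, dist x x = 0)
    (htri : ∀ x y z, dist x z ≤ dist x y + dist y z) (hsymm : ∀ x y, dist x y = dist y x)
    {A A' Δ : Matrix ι ι ℂ} (hA : ∀ x y, A x y ≠ 0 → dist x y ≤ 1)
    (hA' : ∀ x y, A' x y ≠ 0 → dist x y ≤ 1) {θ : ℝ} (hAθ : ‖A‖ ≤ θ) (hA'θ : ‖A'‖ ≤ θ)
    (hθ : θ < 1) (pS pF : ι → Prop) [DecidablePred pS] [DecidablePred pF]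
    (hΔ : (Matrix.diagonal fun k => if pF k then (1 : ℂ) else 0) * Δ *
      (Matrix.diagonal fun k => if pF k then (1 : ℂ) else 0) = Δ)
    {d : ℕ} (hfar : ∀ x y, pS x → pF y → d ≤ dist x y) :
    ‖(Matrix.diagonal fun k => if pS k then (1 : ℂ) else 0) * (1 - A)⁻¹ * Δ * (1 - A')⁻¹ *
        (Matrix.diagonal fun k => if pS k then (1 : ℂ) else 0)‖ ≤
      θ ^ d * (1 / (1 - θ)) * ‖Δ‖ * (1 / (1 - θ)) * θ ^ d := by
  haveI : CompleteSpace (Matrix ι ι ℂ) := FiniteDimensional.complete ℂ _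
  set P : Matrix ι ι ℂ := Matrix.diagonal fun k => if pS k then (1 : ℂ) else 0 with hP
  set Q : Matrix ι ι ℂ := Matrix.diagonal fun k => if pF k then (1 : ℂ) else 0 with hQ
  have hθ0 : 0 ≤ θ := (norm_nonneg A).trans hAθ
  have hUA : IsUnit (1 - A).det :=
    (Matrix.isUnit_iff_isUnit_det _).1 (isUnit_one_sub_of_norm_lt_one (hAθ.trans_lt hθ))
  have hUA' : IsUnit (1 - A').det :=
    (Matrix.isUnit_iff_isUnit_det _).1 (isUnit_one_sub_of_norm_lt_one (hA'θ.trans_lt hθ))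
  -- vanishing of the short paths
  have hvan : ∀ j, j < d → P * A ^ j * Q = 0 := fun j hj =>
    proj_pow_proj_eq_zero dist hd0 htri A hA pS pF fun x y hx hy => lt_of_lt_of_le hj (hfar x y hx hy)
  have hvan' : ∀ j, j < d → Q * A' ^ j * P = 0 := fun j hj =>
    proj_pow_proj_eq_zero' dist hd0 htri hsymm A' hA' pS pF fun x y hx hy =>
      lt_of_lt_of_le hj (hfar x y hx hy)
  -- resummed identities
  have hL : P * (1 - A)⁻¹ * Q = P * A ^ d * (1 - A)⁻¹ * Q := by
    have h := geom_series_eq_sum_add_pow_mul (x := A) (S := (1 - A)⁻¹)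
      (Matrix.mul_nonsing_inv _ hUA) d
    conv_lhs => rw [h]
    rw [Matrix.mul_add, Matrix.add_mul, Matrix.mul_sum, Matrix.sum_mul,
      Finset.sum_eq_zero (fun j hj => hvan j (Finset.mem_range.1 hj)), zero_add, ← Matrix.mul_assoc]
  have hR : Q * (1 - A')⁻¹ * P = Q * (1 - A')⁻¹ * A' ^ d * P := by
    have h := geom_series_eq_sum_add_mul_pow (x := A') (S := (1 - A')⁻¹)
      (Matrix.nonsing_inv_mul _ hUA') d
    conv_lhs => rw [h]
    rw [Matrix.mul_add, Matrix.add_mul, Matrix.mul_sum, Matrix.sum_mul,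
      Finset.sum_eq_zero (fun j hj => hvan' j (Finset.mem_range.1 hj)), zero_add, ← Matrix.mul_assoc]
  have key : P * (1 - A)⁻¹ * Δ * (1 - A')⁻¹ * P =
      (P * (A ^ d * (1 - A)⁻¹)) * Δ * ((1 - A')⁻¹ * A' ^ d * P) := by
    calc P * (1 - A)⁻¹ * Δ * (1 - A')⁻¹ * P
        = (P * (1 - A)⁻¹ * Q) * Δ * (Q * (1 - A')⁻¹ * P) := by
          conv_lhs => rw [← hΔ]
          simp only [Matrix.mul_assoc]
      _ = (P * A ^ d * (1 - A)⁻¹ * Q) * Δ * (Q * (1 - A')⁻¹ * A' ^ d * P) := by rw [hL, hR]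
      _ = (P * (A ^ d * (1 - A)⁻¹)) * (Q * Δ * Q) * ((1 - A')⁻¹ * A' ^ d * P) := by
          simp only [Matrix.mul_assoc]
      _ = (P * (A ^ d * (1 - A)⁻¹)) * Δ * ((1 - A')⁻¹ * A' ^ d * P) := by rw [hΔ]
  rw [key]
  have n1 : ‖P * (A ^ d * (1 - A)⁻¹)‖ ≤ θ ^ d * (1 / (1 - θ)) := by
    calc ‖P * (A ^ d * (1 - A)⁻¹)‖ ≤ ‖P‖ * ‖A ^ d * (1 - A)⁻¹‖ := Matrix.l2_opNorm_mul _ _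
      _ ≤ 1 * (θ ^ d * ‖(1 - A)⁻¹‖) :=
          mul_le_mul (norm_proj_le_one pS) (norm_pow_mul_le hAθ _ _) (norm_nonneg _) zero_le_one
      _ ≤ 1 * (θ ^ d * (1 / (1 - θ))) := by
          gcongr
          exact norm_inv_one_sub_le hAθ hθ
      _ = θ ^ d * (1 / (1 - θ)) := one_mul _
  have n2 : ‖(1 - A')⁻¹ * A' ^ d * P‖ ≤ (1 / (1 - θ)) * θ ^ d := by
    calc ‖(1 - A')⁻¹ * A' ^ d * P‖ ≤ ‖(1 - A')⁻¹ * A' ^ d‖ * ‖P‖ := Matrix.l2_opNorm_mul _ _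
      _ ≤ (‖(1 - A')⁻¹‖ * θ ^ d) * 1 :=
          mul_le_mul (norm_mul_pow_le hA'θ _ _) (norm_proj_le_one pS) (norm_nonneg _)
            (mul_nonneg (norm_nonneg _) (pow_nonneg hθ0 _))
      _ ≤ ((1 / (1 - θ)) * θ ^ d) * 1 := by
          gcongr
          exact norm_inv_one_sub_le hA'θ hθ
      _ = (1 / (1 - θ)) * θ ^ d := mul_one _
  have h1θ : 0 ≤ 1 / (1 - θ) := div_nonneg zero_le_one (by linarith)
  calc ‖P * (A ^ d * (1 - A)⁻¹) * Δ * ((1 - A')⁻¹ * A' ^ d * P)‖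
      ≤ ‖P * (A ^ d * (1 - A)⁻¹) * Δ‖ * ‖(1 - A')⁻¹ * A' ^ d * P‖ := Matrix.l2_opNorm_mul _ _
    _ ≤ (‖P * (A ^ d * (1 - A)⁻¹)‖ * ‖Δ‖) * ‖(1 - A')⁻¹ * A' ^ d * P‖ := by
        gcongr; exact Matrix.l2_opNorm_mul _ _
    _ ≤ (θ ^ d * (1 / (1 - θ)) * ‖Δ‖) * ((1 / (1 - θ)) * θ ^ d) := by
        gcongr
    _ = θ ^ d * (1 / (1 - θ)) * ‖Δ‖ * (1 / (1 - θ)) * θ ^ d := by ring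

end RangeOne

section Dist

variable {L : ℕ} [NeZero L]

omit [NeZero L] in
/-- `dist x x = 0`. -/
theorem siteDist_self (x : TorusSite 4 L) : (∑ i, (x i - x i).valMinAbs.natAbs) = 0 := by
  simp

omit [NeZero L] in
/-- Symmetry. -/
theorem siteDist_comm (x y : TorusSite 4 L) :
    (∑ i, (x i - y i).valMinAbs.natAbs) = ∑ i, (y i - x i).valMinAbs.natAbs :=
  Finset.sum_congr rfl fun i _ => by rw [← neg_sub, ZMod.natAbs_valMinAbs_neg]

/-- Triangle inequality. -/
theorem siteDist_triangle (x y z : TorusSite 4 L) :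
    (∑ i, (x i - z i).valMinAbs.natAbs) ≤
      (∑ i, (x i - y i).valMinAbs.natAbs) + ∑ i, (y i - z i).valMinAbs.natAbs := by
  rw [← Finset.sum_add_distrib]
  exact Finset.sum_le_sum fun i _ => by
    rw [show x i - z i = (x i - y i) + (y i - z i) by ring]
    exact natAbs_valMinAbs_add_le' _ _

/-- One hop has length at most `1`. -/
theorem siteDist_shift_le (x : TorusSite 4 L) (μ : Fin 4) :
    (∑ i, (x i - (Site.shift x μ) i).valMinAbs.natAbs) ≤ 1 := by
  simp only [Site.shift, Pi.add_apply, sub_add_cancel_left, ZMod.natAbs_valMinAbs_neg]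
  rw [Finset.sum_eq_single μ (fun i _ hi => by rw [Pi.single_eq_of_ne hi, ZMod.valMinAbs_zero,
      Int.natAbs_zero]) (fun h => absurd (Finset.mem_univ μ) h), Pi.single_eq_same]
  simpa using natAbs_valMinAbs_intCast_le (L := L) 1

/-- One hop has length at most `1` (reversed). -/
theorem siteDist_shift_le' (x : TorusSite 4 L) (μ : Fin 4) :
    (∑ i, ((Site.shift x μ) i - x i).valMinAbs.natAbs) ≤ 1 :=
  (siteDist_comm _ _).trans_le (siteDist_shift_le x μ)

end Dist

section Wilson

variable {L N : ℕ} [NeZero L] {G : Type*} [Group G] (ρ : G →* Matrix (Fin N) (Fin N) ℂ)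

/-- **Range one**: a non-zero entry of the Wilson matrix joins indices at site distance `≤ 1`. -/
theorem siteDist_le_one_of_wilsonDirac_ne_zero (V : GaugeConfig 4 L G) (m r : ℝ)
    {p q : TorusSite 4 L × Fin N × Fin 4} (h : wilsonDirac ρ V m r p q ≠ 0) :
    (∑ i, (p.1 i - q.1 i).valMinAbs.natAbs) ≤ 1 := by
  by_contra hfar
  push Not at hfar
  refine h (wilsonDirac_apply_eq_zero_of_far ρ V m r ?_ ?_ ?_)
  · intro hpq; rw [hpq, siteDist_self] at hfar; omega
  · intro μ hq; rw [hq] at hfar; exact absurd (siteDist_shift_le p.1 μ) (by omega)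
  · intro μ hp; rw [hp] at hfar; exact absurd (siteDist_shift_le' q.1 μ) (by omega)

/-- The same for `1 − c • D_W`. -/
theorem siteDist_le_one_of_one_sub_smul_ne_zero (V : GaugeConfig 4 L G) (m r : ℝ) (c : ℂ)
    {p q : TorusSite 4 L × Fin N × Fin 4}
    (h : ((1 : Matrix (TorusSite 4 L × Fin N × Fin 4) (TorusSite 4 L × Fin N × Fin 4) ℂ) -
      c • wilsonDirac ρ V m r) p q ≠ 0) :
    (∑ i, (p.1 i - q.1 i).valMinAbs.natAbs) ≤ 1 := by
  by_cases hpq : p = q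
  · rw [hpq, siteDist_self]; exact zero_le_one
  · rw [Matrix.sub_apply, Matrix.one_apply_ne hpq, Matrix.smul_apply, zero_sub, neg_ne_zero,
      smul_eq_mul] at h
    exact siteDist_le_one_of_wilsonDirac_ne_zero ρ V m r (right_ne_zero_of_mul h)

omit [NeZero L] in
/-- **Entry formula** of `wilsonDirac` through two abstract families of link terms. -/
theorem wilsonDirac_apply_eq_sum (V : GaugeConfig 4 L G) (m r : ℝ)
    (p q : TorusSite 4 L × Fin N × Fin 4) (T₁ T₂ : Fin 4 → G → ℂ)
    (hT₁ : ∀ μ g, T₁ μ g = if q.1 = Site.shift p.1 μ then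
      ((r : ℂ) • (1 : Matrix (Fin 4) (Fin 4) ℂ) - euclideanGamma μ) p.2.2 q.2.2 * ρ g p.2.1 q.2.1 else 0)
    (hT₂ : ∀ μ g, T₂ μ g = if p.1 = Site.shift q.1 μ then
      ((r : ℂ) • (1 : Matrix (Fin 4) (Fin 4) ℂ) + euclideanGamma μ) p.2.2 q.2.2 * ρ g⁻¹ p.2.1 q.2.1 else 0) :
    wilsonDirac ρ V m r p q = (if p = q then ((m + 4 * r : ℝ) : ℂ) else 0) -
      (1 / 2 : ℂ) * ∑ μ : Fin 4, (T₁ μ (V (p.1, μ)) + T₂ μ (V (q.1, μ))) := by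
  simp only [wilsonDirac, Matrix.of_apply, hT₁, hT₂]

omit [NeZero L] in
/-- Entries of the Wilson matrix only read the links based at the two sites of the entry. -/
theorem wilsonDirac_apply_congr {V W : GaugeConfig 4 L G} (m r : ℝ)
    {p q : TorusSite 4 L × Fin N × Fin 4} (hp : ∀ μ, V (p.1, μ) = W (p.1, μ))
    (hq : ∀ μ, V (q.1, μ) = W (q.1, μ)) : wilsonDirac ρ V m r p q = wilsonDirac ρ W m r p q := by
  simp only [wilsonDirac, Matrix.of_apply, hp, hq]

omit [NeZero L] in
/-- **A single-link update only touches the block of the two endpoints**: outside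
`S = {x₀, x₀ + μ̂₀} × colour × spin` (in both indices) the entries of `D(U[e₀ ↦ u])` do not
depend on `u`. -/
theorem wilsonDirac_update_sub_update_apply_eq_zero (V : GaugeConfig 4 L G) (e₀ : Edge 4 L)
    (u u' : G) (m r : ℝ) {p q : TorusSite 4 L × Fin N × Fin 4}
    (h : ¬ ((p.1 = e₀.1 ∨ p.1 = Site.shift e₀.1 e₀.2) ∧ (q.1 = e₀.1 ∨ q.1 = Site.shift e₀.1 e₀.2))) :
    (wilsonDirac ρ (Function.update V e₀ u) m r - wilsonDirac ρ (Function.update V e₀ u') m r) p q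
      = 0 := by
  rw [Matrix.sub_apply, sub_eq_zero]
  simp only [wilsonDirac, Matrix.of_apply]
  congr 2
  refine Finset.sum_congr rfl fun μ _ => ?_
  congr 1
  · split_ifs with hq
    · by_cases he : (p.1, μ) = e₀
      · exfalso; apply h; subst he; exact ⟨Or.inl rfl, Or.inr hq⟩
      · rw [Function.update_of_ne he, Function.update_of_ne he]
    · rfl
  · split_ifs with hp
    · by_cases he : (q.1, μ) = e₀
      · exfalso; apply h; subst he; exact ⟨Or.inr hp, Or.inl rfl⟩
      · rw [Function.update_of_ne he, Function.update_of_ne he]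
    · rfl

omit [NeZero L] in
/-- **The update difference does not see the other links**:
`D(U[e₀ ↦ u]) − D(U[e₀ ↦ u']) = D(U'[e₀ ↦ u]) − D(U'[e₀ ↦ u'])` for ANY `U, U'`. -/
theorem wilsonDirac_update_sub_update_eq (U U' : GaugeConfig 4 L G) (e₀ : Edge 4 L) (u u' : G)
    (m r : ℝ) :
    wilsonDirac ρ (Function.update U e₀ u) m r - wilsonDirac ρ (Function.update U e₀ u') m r =
      wilsonDirac ρ (Function.update U' e₀ u) m r - wilsonDirac ρ (Function.update U' e₀ u') m r := by
  ext p q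
  set T₁ : Fin 4 → G → ℂ := fun μ g => if q.1 = Site.shift p.1 μ then
      ((r : ℂ) • (1 : Matrix (Fin 4) (Fin 4) ℂ) - euclideanGamma μ) p.2.2 q.2.2 * ρ g p.2.1 q.2.1 else 0
    with hT₁
  set T₂ : Fin 4 → G → ℂ := fun μ g => if p.1 = Site.shift q.1 μ then
      ((r : ℂ) • (1 : Matrix (Fin 4) (Fin 4) ℂ) + euclideanGamma μ) p.2.2 q.2.2 * ρ g⁻¹ p.2.1 q.2.1 else 0
    with hT₂
  have hE : ∀ W : GaugeConfig 4 L G, wilsonDirac ρ W m r p q = (if p = q then ((m + 4 * r : ℝ) : ℂ) else 0) -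
      (1 / 2 : ℂ) * ∑ μ : Fin 4, (T₁ μ (W (p.1, μ)) + T₂ μ (W (q.1, μ))) := fun W =>
    wilsonDirac_apply_eq_sum ρ W m r p q T₁ T₂ (fun μ g => by rw [hT₁]) (fun μ g => by rw [hT₂])
  rw [Matrix.sub_apply, Matrix.sub_apply, hE, hE, hE, hE]
  have key : ∀ μ : Fin 4,
      T₁ μ (Function.update U e₀ u (p.1, μ)) + T₂ μ (Function.update U e₀ u (q.1, μ)) -
        (T₁ μ (Function.update U e₀ u' (p.1, μ)) + T₂ μ (Function.update U e₀ u' (q.1, μ))) =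
      T₁ μ (Function.update U' e₀ u (p.1, μ)) + T₂ μ (Function.update U' e₀ u (q.1, μ)) -
        (T₁ μ (Function.update U' e₀ u' (p.1, μ)) + T₂ μ (Function.update U' e₀ u' (q.1, μ))) := by
    intro μ
    simp only [Function.update_apply]
    by_cases h1 : (p.1, μ) = e₀ <;> by_cases h2 : (q.1, μ) = e₀ <;> simp [h1, h2]
  have hsum := Finset.sum_congr rfl fun μ (_ : μ ∈ (Finset.univ : Finset (Fin 4))) => key μ
  rw [Finset.sum_sub_distrib, Finset.sum_sub_distrib] at hsum
  linear_combination (-(1 / 2 : ℂ)) * hsum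

/-- **Two fields agreeing near `e₀` have Wilson matrices agreeing except far away**: if `U, U'`
agree on every link `e ≠ e₀` based within distance `Λ` of `x₀ = e₀.1`, then the entries of
`D(U[e₀ ↦ u])` and `D(U'[e₀ ↦ u])` agree unless both indices are at distance `≥ Λ` from `x₀`. -/
theorem wilsonDirac_update_apply_eq_of_agree {U U' : GaugeConfig 4 L G} {e₀ : Edge 4 L} {Λ : ℕ}
    (hUU' : ∀ e : Edge 4 L, (∑ i, (e.1 i - e₀.1 i).valMinAbs.natAbs) ≤ Λ → e ≠ e₀ → U e = U' e)
    (u : G) (m r : ℝ) {p q : TorusSite 4 L × Fin N × Fin 4}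
    (h : ¬ (Λ ≤ (∑ i, (p.1 i - e₀.1 i).valMinAbs.natAbs) ∧ Λ ≤ ∑ i, (q.1 i - e₀.1 i).valMinAbs.natAbs)) :
    wilsonDirac ρ (Function.update U e₀ u) m r p q = wilsonDirac ρ (Function.update U' e₀ u) m r p q := by
  -- links based at a site within distance `Λ` agree after the update
  have hagree : ∀ y : TorusSite 4 L, (∑ i, (y i - e₀.1 i).valMinAbs.natAbs) ≤ Λ →
      ∀ μ, Function.update U e₀ u (y, μ) = Function.update U' e₀ u (y, μ) := by
    intro y hy μ
    by_cases he : (y, μ) = e₀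
    · rw [he, Function.update_self, Function.update_self]
    · rw [Function.update_of_ne he, Function.update_of_ne he]
      exact hUU' (y, μ) hy he
  by_cases hD : wilsonDirac ρ (Function.update U e₀ u) m r p q = 0 ∧
      wilsonDirac ρ (Function.update U' e₀ u) m r p q = 0
  · rw [hD.1, hD.2]
  · -- the entry is within hopping range, so `p.1, q.1` are at distance `≤ 1`
    have hnear : (∑ i, (p.1 i - q.1 i).valMinAbs.natAbs) ≤ 1 := by
      rw [not_and_or] at hD
      rcases hD with hD | hD
      · exact siteDist_le_one_of_wilsonDirac_ne_zero ρ _ m r hD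
      · exact siteDist_le_one_of_wilsonDirac_ne_zero ρ _ m r hD
    rw [not_and_or, not_le, not_le] at h
    have tpq := siteDist_triangle q.1 p.1 e₀.1
    have tqp := siteDist_triangle p.1 q.1 e₀.1
    rw [siteDist_comm q.1 p.1] at tpq
    rcases h with hp | hq
    · exact wilsonDirac_apply_congr ρ m r (hagree p.1 hp.le) (hagree q.1 (by omega))
    · exact wilsonDirac_apply_congr ρ m r (hagree p.1 (by omega)) (hagree q.1 hq.le)

open scoped Matrix.Norms.L2Operator

/-- `‖D_W(V) − (m+4)·1‖ ≤ 4` (unitary `ρ`, `m + 4 > 0`, `r = 1`): four hopping isometries. -/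
theorem norm_wilsonDirac_sub_smul_one_le (hρ : ∀ g, ρ g ∈ Matrix.unitaryGroup (Fin N) ℂ)
    (V : GaugeConfig 4 L G) {m : ℝ} (hm : 0 < m + 4) :
    ‖wilsonDirac ρ V m 1 - ((m + 4 : ℝ) : ℂ) • (1 : Matrix _ _ ℂ)‖ ≤ 4 := by
  have h := norm_one_sub_smul_wilsonDirac_le ρ hρ V m hm
  have hc : ((m + 4 : ℝ) : ℂ) ≠ 0 := by exact_mod_cast hm.ne'
  have heq : wilsonDirac ρ V m 1 - ((m + 4 : ℝ) : ℂ) • (1 : Matrix _ _ ℂ) =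
      -(((m + 4 : ℝ) : ℂ) • ((1 : Matrix _ _ ℂ) - ((m + 4 : ℝ) : ℂ)⁻¹ • wilsonDirac ρ V m 1)) := by
    rw [smul_sub, smul_smul, mul_inv_cancel₀ hc, one_smul, neg_sub]
  rw [heq, norm_neg, norm_smul, Complex.norm_real, Real.norm_eq_abs, abs_of_pos hm]
  calc (m + 4) * ‖(1 : Matrix _ _ ℂ) - ((m + 4 : ℝ) : ℂ)⁻¹ • wilsonDirac ρ V m 1‖
      ≤ (m + 4) * (4 / (m + 4)) := mul_le_mul_of_nonneg_left h hm.le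
    _ = 4 := mul_div_cancel₀ _ hm.ne'

/-- `‖D_W(V) − D_W(W)‖ ≤ 8` for any two gauge fields. -/
theorem norm_wilsonDirac_sub_wilsonDirac_le (hρ : ∀ g, ρ g ∈ Matrix.unitaryGroup (Fin N) ℂ)
    (V W : GaugeConfig 4 L G) {m : ℝ} (hm : 0 < m + 4) :
    ‖wilsonDirac ρ V m 1 - wilsonDirac ρ W m 1‖ ≤ 8 := by
  rw [show wilsonDirac ρ V m 1 - wilsonDirac ρ W m 1 =
      (wilsonDirac ρ V m 1 - ((m + 4 : ℝ) : ℂ) • (1 : Matrix _ _ ℂ)) -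
        (wilsonDirac ρ W m 1 - ((m + 4 : ℝ) : ℂ) • (1 : Matrix _ _ ℂ)) by abel]
  calc _ ≤ ‖wilsonDirac ρ V m 1 - ((m + 4 : ℝ) : ℂ) • (1 : Matrix _ _ ℂ)‖ +
        ‖wilsonDirac ρ W m 1 - ((m + 4 : ℝ) : ℂ) • (1 : Matrix _ _ ℂ)‖ := norm_sub_le _ _
    _ ≤ 4 + 4 := add_le_add (norm_wilsonDirac_sub_smul_one_le ρ hρ V hm)
        (norm_wilsonDirac_sub_smul_one_le ρ hρ W hm)
    _ = 8 := by norm_num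

end Wilson

end UniformLoopPotential

end Summit.QuantumFields.QCD.Theorems

end
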